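import Mathlib.Analysis.Complex.PhragmenLindelof
import Mathlib.Analysis.Complex.OpenMapping
import Mathlib.Analysis.Complex.ReImTopology
import Mathlib.Analysis.Complex.Convex
import Mathlib.Analysis.SpecialFunctions.Pow.Deriv
import Mathlib.Analysis.SpecialFunctions.Pow.Continuity
import Mathlib.Analysis.Calculus.Deriv.Star
import HarnessLib

/-!
# Bounded analytic functions on a horizontal strip: boundary values

Analysis/Complex support file (everything proved; no definitions, no named facts). For the closed
horizontal strip `𝕊̄_a = {0 ≤ im z ≤ a}` (`im ⁻¹' Icc 0 a`), its interior `𝕊_a = im ⁻¹' Ioo 0 a` and a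
Banach-space valued `f`:

* `norm_le_of_strip` — the **Phragmén–Lindelöf / three-lines bound** for a bounded `f`, analytic
  in `𝕊_a` and continuous on `𝕊̄_a`: `‖f‖ ≤ C` on both boundary lines gives `‖f‖ ≤ C` on `𝕊̄_a`
  (Mathlib's `PhragmenLindelof.horizontal_strip` with the trivial growth bound);
* `eq_zero_of_strip`, `eq_zero_of_strip_of_eqOn_real` — **uniqueness from ONE boundary line**: a
  bounded `f`, analytic in `𝕊_a`, continuous on `𝕊̄_a` (resp. only on the half-open strip
  `im ⁻¹' Ico 0 a`) and vanishing on `ℝ` vanishes identically (`e^{iλz} f` and `λ → ∞`; for the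
  half-open version work on sub-strips `𝕊_b`, `b < a`);
* `norm_le_of_strip_off_point` — **Phragmén–Lindelöf with one exceptional boundary point**
  (Lindelöf): if `f` is analytic in `𝕊_a`, bounded on `𝕊̄_a ∖ {p}` and continuous there, `p` on
  the upper boundary line, and `‖f‖ ≤ C` on `∂𝕊_a ∖ {p}`, then `‖f‖ ≤ C` in `𝕊_a`. Proof: the
  auxiliary analytic function `ψ_ε(z) = b(e^{πz/a})^ε`, `b(w) = (w − P)/(w − P + i)`,
  `P = e^{πp/a} < 0`, has modulus `≤ 1` on `𝕊̄_a`, vanishes exactly at `p` and tends to `1`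
  pointwise as `ε ↓ 0`; `ψ_ε • f` is continuous on all of `𝕊̄_a`, so the plain principle applies;
* `eq_const_of_im_eq_zero_on_boundary` — a bounded analytic `f : 𝕊_a → ℂ`, continuous on
  `𝕊̄_a ∖ {p}` and REAL on both boundary lines (off `p`) is constant (apply the previous result
  to `e^{± i f}`, so `im f = 0` inside, then the open mapping theorem
  `AnalyticOnNhd.eq_const_of_im_eq_const`). This is the Liouville/Schwarz-reflection step of
  Araki–Zsidó's and Longo's proofs of the half-sided modular inclusion theorem (R. Longo,
  *Lectures on Conformal Nets* I, proof of Thm. 2.3.3: "by the Schwarz reflection principle we can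
  extend `F` to a bounded function analytic on the complex plane except for `z ∈ −t + i/2 + iℤ`
  … removable … constant by Liouville theorem"), done here without reflection;
* `differentiableAt_conj_comp_neg_conj` — `z ↦ conj (g (−z̄))` is holomorphic where `g` is
  (Mathlib's `HasDerivAt.conj_conj`).

References: E. Lindelöf (1915) / standard Phragmén–Lindelöf theory, e.g. B. Ya. Levin, *Lectures
on entire functions* (1996), Lect. 6; R. Longo, *Lectures on Conformal Nets* I (2008), §2.3.
All statements are folklore.

## Mathlib

`PhragmenLindelof.horizontal_strip`, `Complex.closure_preimage_im`,
`AnalyticOnNhd.eq_const_of_im_eq_const` (open mapping), `Complex.norm_cpow_real`,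
`DifferentiableAt.cpow_const`, `HasDerivAt.conj_conj`, `Set.EqOn.of_subset_closure`. The pattern of
`norm_le_of_strip`/`eq_zero_of_strip` is the one of
`Literature.Analysis.FunctionSpaces.norm_le_of_kmsStrip` / `eq_zero_of_kmsStrip` (KMS strip, heavy
C⋆-imports), restated here import-light for general `a`.
-/

noncomputable section

open Set Filter Metric Complex
open _root_.Topology
open scoped ComplexConjugate Real

namespace Literature.Analysis.Complex

variable {E : Type*} [NormedAddCommGroup E] [NormedSpace ℂ E] {a : ℝ}

/-! ### Phragmén–Lindelöf on a strip and uniqueness from the real line -/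

/-- The closure of the open strip `0 < im z < a` is the closed strip. [folklore] -/
theorem closure_im_preimage_Ioo (ha : 0 < a) : closure (im ⁻¹' Ioo 0 a) = im ⁻¹' Icc 0 a := by
  rw [closure_preimage_im, closure_Ioo ha.ne]

/-- The closed strip is the closure of the half-open strip `0 ≤ im z < a`. [folklore] -/
theorem closure_im_preimage_Ico (ha : 0 < a) : closure (im ⁻¹' Ico 0 a) = im ⁻¹' Icc 0 a := by
  rw [closure_preimage_im, closure_Ico ha.ne]

/-- The open strip `0 < im z < a` is open. [folklore] -/
theorem isOpen_im_preimage_Ioo : IsOpen (im ⁻¹' Ioo 0 a) :=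
  isOpen_Ioo.preimage continuous_im

/-- The open strip is convex. [folklore] -/
theorem convex_im_preimage_Ioo : Convex ℝ (im ⁻¹' Ioo 0 a) := by
  have : im ⁻¹' Ioo 0 a = {z : ℂ | 0 < z.im} ∩ {z : ℂ | z.im < a} := by
    ext z; simp
  rw [this]
  exact (convex_halfSpace_im_gt 0).inter (convex_halfSpace_im_lt a)

/-- **Phragmén–Lindelöf on the strip `0 ≤ im z ≤ a`**: a function analytic in the open strip,
continuous and bounded on the closed strip and bounded by `C` on both boundary lines is bounded
by `C` on the closed strip. [folklore] -/
theorem norm_le_of_strip (ha : 0 < a) {f : ℂ → E} (hd : DiffContOnCl ℂ f (im ⁻¹' Ioo 0 a))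
    {K : ℝ} (hK : ∀ z ∈ im ⁻¹' Icc 0 a, ‖f z‖ ≤ K) {C : ℝ} (h0 : ∀ z : ℂ, z.im = 0 → ‖f z‖ ≤ C)
    (h1 : ∀ z : ℂ, z.im = a → ‖f z‖ ≤ C) {z : ℂ} (hz : z ∈ im ⁻¹' Icc 0 a) : ‖f z‖ ≤ C := by
  refine PhragmenLindelof.horizontal_strip hd ⟨0, ?_, 0, ?_⟩ h0 h1 hz.1 hz.2
  · rw [sub_zero]; exact div_pos Real.pi_pos ha
  · refine Asymptotics.IsBigO.of_bound (max K 0)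
      (eventually_inf_principal.2 (Eventually.of_forall fun w hw => ?_))
    have : ‖f w‖ ≤ max K 0 := (hK w ⟨hw.1.le, hw.2.le⟩).trans (le_max_left K 0)
    simpa using this

/-- **Uniqueness on the strip from the real line**: a function analytic in the open strip
`0 < im z < a`, continuous and bounded on the closed strip, and vanishing on `ℝ`, vanishes on the
closed strip (Phragmén–Lindelöf for `e^{iλz} f` and `λ → ∞`; the top edge by continuity).
[folklore] -/
theorem eq_zero_of_strip (ha : 0 < a) {f : ℂ → E} (hd : DiffContOnCl ℂ f (im ⁻¹' Ioo 0 a))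
    {K : ℝ} (hK : ∀ z ∈ im ⁻¹' Icc 0 a, ‖f z‖ ≤ K) (h0 : ∀ t : ℝ, f t = 0) {z : ℂ}
    (hz : z ∈ im ⁻¹' Icc 0 a) : f z = 0 := by
  -- Step 1: below the top edge.
  have key : EqOn f 0 (im ⁻¹' Ico 0 a) := by
    intro w hw
    have hnorm : ∀ (L : ℝ) (z : ℂ), ‖cexp (I * L * z)‖ = Real.exp (-(L * z.im)) := by
      intro L z
      rw [norm_exp]
      congr 1
      simp [mul_re]
    have hL : ∀ L : ℝ, 0 < L → ‖f w‖ ≤ Real.exp (-(L * (a - w.im))) * K := by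
      intro L hL
      have hgd : DiffContOnCl ℂ (fun z => cexp (I * L * z) • f z) (im ⁻¹' Ioo 0 a) :=
        (Differentiable.diffContOnCl (by fun_prop)).smul hd
      have hgK : ∀ z ∈ im ⁻¹' Icc 0 a, ‖cexp (I * L * z) • f z‖ ≤ K := by
        intro z hz
        rw [norm_smul, hnorm]
        calc Real.exp (-(L * z.im)) * ‖f z‖ ≤ 1 * K :=
              mul_le_mul (Real.exp_le_one_iff.2 (by nlinarith [hz.1])) (hK z hz) (norm_nonneg _)
                zero_le_one
          _ = K := one_mul K
      have hb0 : ∀ z : ℂ, z.im = 0 → ‖cexp (I * L * z) • f z‖ ≤ Real.exp (-(L * a)) * K := by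
        intro z hz0
        have hz' : z = (z.re : ℂ) := Complex.ext (by simp) (by simp [hz0])
        have hK0 : 0 ≤ K := (norm_nonneg _).trans (hK w ⟨hw.1, hw.2.le⟩)
        rw [hz', h0, smul_zero, norm_zero]
        positivity
      have hb1 : ∀ z : ℂ, z.im = a → ‖cexp (I * L * z) • f z‖ ≤ Real.exp (-(L * a)) * K := by
        intro z hz1
        rw [norm_smul, hnorm, hz1]
        exact mul_le_mul_of_nonneg_left (hK z (by simp [hz1, ha.le])) (Real.exp_pos _).le
      have := norm_le_of_strip ha hgd hgK hb0 hb1 (z := w) ⟨hw.1, hw.2.le⟩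
      rw [norm_smul, hnorm, ← le_div_iff₀' (Real.exp_pos _)] at this
      refine this.trans (le_of_eq ?_)
      rw [mul_div_right_comm, ← Real.exp_sub]
      ring_nf
    have hc : 0 < a - w.im := sub_pos.2 hw.2
    have ht : Tendsto (fun L : ℝ => Real.exp (-(L * (a - w.im))) * K) atTop (𝓝 (0 * K)) :=
      (Real.tendsto_exp_atBot.comp
        (tendsto_neg_atTop_atBot.comp (tendsto_id.atTop_mul_const hc))).mul_const K
    rw [zero_mul] at ht
    have : ‖f w‖ ≤ 0 :=
      ge_of_tendsto ht (Filter.eventually_atTop.2 ⟨1, fun L hL1 => hL L (by linarith)⟩)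
    exact norm_le_zero_iff.1 this
  -- Step 2: the top edge, by continuity.
  have hcont : ContinuousOn f (im ⁻¹' Icc 0 a) := by
    rw [← closure_im_preimage_Ioo ha]; exact hd.continuousOn
  have heq : EqOn f 0 (im ⁻¹' Icc 0 a) := by
    refine key.of_subset_closure hcont continuousOn_const (fun w hw => ⟨hw.1, hw.2.le⟩) ?_
    rw [closure_im_preimage_Ico ha]
  exact heq hz

/-- **Uniqueness from the real line, without continuity at the top edge**: a function analytic in
the open strip `0 < im z < a`, continuous and bounded on the HALF-OPEN strip `0 ≤ im z < a` and
vanishing on `ℝ` vanishes there (apply `eq_zero_of_strip` on the sub-strips `0 ≤ im z ≤ b`,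
`b < a`). [folklore] -/
theorem eq_zero_of_strip_of_eqOn_real (ha : 0 < a) {f : ℂ → E}
    (hd : DifferentiableOn ℂ f (im ⁻¹' Ioo 0 a)) (hc : ContinuousOn f (im ⁻¹' Ico 0 a))
    {K : ℝ} (hK : ∀ z ∈ im ⁻¹' Ico 0 a, ‖f z‖ ≤ K) (h0 : ∀ t : ℝ, f t = 0) {z : ℂ}
    (hz : z ∈ im ⁻¹' Ico 0 a) : f z = 0 := by
  have _ := ha
  obtain ⟨b, hzb, hba⟩ := exists_between hz.2
  have hb : 0 < b := lt_of_le_of_lt hz.1 hzb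
  have hsub : im ⁻¹' Icc 0 b ⊆ im ⁻¹' Ico 0 a := fun w hw => ⟨hw.1, lt_of_le_of_lt hw.2 hba⟩
  have hd' : DiffContOnCl ℂ f (im ⁻¹' Ioo 0 b) := by
    refine ⟨hd.mono fun w hw => ⟨hw.1, hw.2.trans hba⟩, ?_⟩
    rw [closure_im_preimage_Ioo hb]
    exact hc.mono hsub
  exact eq_zero_of_strip hb hd' (fun w hw => hK w (hsub hw)) h0 ⟨hz.1, hzb.le⟩

/-! ### Phragmén–Lindelöf with one exceptional boundary point -/

section OffPoint

/-- `im e^{πz/a} = e^{π re z / a} sin (π im z / a)`. [folklore] -/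
private theorem exp_mul_im (z : ℂ) :
    (cexp (↑(π / a) * z)).im = Real.exp (π / a * z.re) * Real.sin (π / a * z.im) := by
  simp [exp_im]

/-- `im e^{πz/a} ≥ 0` on the closed strip `0 ≤ im z ≤ a`. [folklore] -/
private theorem exp_mul_im_nonneg (ha : 0 < a) {z : ℂ} (hz : z ∈ im ⁻¹' Icc 0 a) :
    0 ≤ (cexp (↑(π / a) * z)).im := by
  rw [exp_mul_im]
  refine mul_nonneg (Real.exp_pos _).le (Real.sin_nonneg_of_nonneg_of_le_pi ?_ ?_)
  · exact mul_nonneg (div_pos Real.pi_pos ha).le hz.1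
  · calc π / a * z.im ≤ π / a * a := mul_le_mul_of_nonneg_left hz.2 (div_pos Real.pi_pos ha).le
      _ = π := by field_simp

/-- `e^{πp/a}` is real for `im p = a`. [folklore] -/
private theorem exp_mul_im_eq_zero (ha : 0 < a) {p : ℂ} (hp : p.im = a) :
    (cexp (↑(π / a) * p)).im = 0 := by
  rw [exp_mul_im, hp]
  have : π / a * a = π := by field_simp
  rw [this, Real.sin_pi, mul_zero]

/-- On the closed strip, `e^{πz/a} = e^{πp/a}` forces `z = p` (the period `2ai` does not fit).
[folklore] -/
private theorem exp_mul_eq_iff (ha : 0 < a) {z p : ℂ} (hz : z ∈ im ⁻¹' Icc 0 a)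
    (hp : p ∈ im ⁻¹' Icc 0 a) : cexp (↑(π / a) * z) = cexp (↑(π / a) * p) ↔ z = p := by
  refine ⟨fun h => ?_, fun h => by rw [h]⟩
  obtain ⟨n, hn⟩ := Complex.exp_eq_exp_iff_exists_int.1 h
  have hπa : (↑(π / a) : ℂ) ≠ 0 := ofReal_ne_zero.2 (div_pos Real.pi_pos ha).ne'
  have ha' : (a : ℂ) ≠ 0 := ofReal_ne_zero.2 ha.ne'
  have hz_eq : z = p + n * (2 * a * I) := by
    have : (↑(π / a) : ℂ) * z = ↑(π / a) * (p + n * (2 * a * I)) := by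
      rw [hn]; push_cast; field_simp
    exact mul_left_cancel₀ hπa this
  have him : z.im = p.im + n * (2 * a) := by
    have := congrArg im hz_eq
    simpa using this
  have hn0 : (n : ℝ) = 0 := by
    have h1 : (n : ℝ) * (2 * a) ≤ a := by nlinarith [hz.2, hp.1]
    have h2 : -a ≤ (n : ℝ) * (2 * a) := by nlinarith [hz.1, hp.2]
    have h3 : (n : ℝ) < 1 := by nlinarith
    have h4 : (-1 : ℝ) < n := by nlinarith
    have h5 : n < 1 := by exact_mod_cast h3
    have h6 : -1 < n := by exact_mod_cast h4
    have : n = 0 := by omega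
    simp [this]
  rw [hz_eq]
  have : (n : ℂ) = 0 := by exact_mod_cast hn0
  simp [this]

/-- For `im v ≥ 0`, `v + i ≠ 0`. [folklore] -/
private theorem add_I_ne_zero {v : ℂ} (hv : 0 ≤ v.im) : v + I ≠ 0 := by
  intro h
  have := congrArg im h
  simp only [add_im, I_im, zero_im] at this
  linarith

/-- The Blaschke-type factor `v/(v + i)` of the upper half-plane has modulus `≤ 1` for
`im v ≥ 0`. [folklore] -/
private theorem norm_div_add_I_le_one {v : ℂ} (hv : 0 ≤ v.im) : ‖v / (v + I)‖ ≤ 1 := by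
  rw [norm_div, div_le_one (norm_pos_iff.2 (add_I_ne_zero hv))]
  have h2 : ‖v‖ ^ 2 ≤ ‖v + I‖ ^ 2 := by
    rw [← normSq_eq_norm_sq, ← normSq_eq_norm_sq, normSq_apply, normSq_apply]
    simp only [add_re, I_re, add_zero, add_im, I_im]
    nlinarith
  exact (sq_le_sq₀ (norm_nonneg _) (norm_nonneg _)).1 h2

/-- For `im v ≥ 0`, `v ≠ 0`, the factor `v/(v + i)` has positive real part, so lies in the slit
plane. [folklore] -/
private theorem div_add_I_mem_slitPlane {v : ℂ} (hv : 0 ≤ v.im) (hv0 : v ≠ 0) :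
    v / (v + I) ∈ slitPlane := by
  have hden : v + I ≠ 0 := add_I_ne_zero hv
  refine Or.inl ?_
  rw [div_re]
  simp only [add_re, I_re, add_zero, add_im, I_im]
  have hns : 0 < normSq (v + I) := normSq_pos.2 hden
  rw [← add_div]
  refine div_pos ?_ hns
  have : 0 < v.re * v.re + v.im * v.im := by
    have := normSq_pos.2 hv0
    rwa [normSq_apply] at this
  nlinarith

/-- **Phragmén–Lindelöf with one exceptional boundary point.** Let `f` be analytic in the open
strip `0 < im z < a`, continuous and bounded on the closed strip minus a point `p` of the upper
boundary line, and `‖f‖ ≤ C` on both boundary lines off `p`. Then `‖f‖ ≤ C` in the open strip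
(and hence, by continuity, on the closed strip off `p`). [folklore] -/
theorem norm_le_of_strip_off_point (ha : 0 < a) {f : ℂ → E} {p : ℂ} (hp : p.im = a)
    (hd : DifferentiableOn ℂ f (im ⁻¹' Ioo 0 a)) (hc : ContinuousOn f (im ⁻¹' Icc 0 a \ {p}))
    {K : ℝ} (hK : ∀ z ∈ im ⁻¹' Icc 0 a \ {p}, ‖f z‖ ≤ K) {C : ℝ}
    (h0 : ∀ z : ℂ, z.im = 0 → ‖f z‖ ≤ C) (h1 : ∀ z : ℂ, z.im = a → z ≠ p → ‖f z‖ ≤ C) {z : ℂ}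
    (hz : z ∈ im ⁻¹' Ioo 0 a) : ‖f z‖ ≤ C := by
  have hC0 : 0 ≤ C := (norm_nonneg _).trans (h0 0 rfl)
  have hK0 : 0 ≤ K := by
    have h := hK z ⟨⟨hz.1.le, hz.2.le⟩, fun h => by
      have : z.im = a := by rw [show z = p from h, hp]
      exact hz.2.ne this⟩
    exact (norm_nonneg _).trans h
  have hpmem : p ∈ im ⁻¹' Icc 0 a := by simp [hp, ha.le]
  have hzcl : z ∈ im ⁻¹' Icc 0 a := ⟨hz.1.le, hz.2.le⟩
  have hzp : z ≠ p := fun h => hz.2.ne (by rw [h, hp])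
  -- the regularised functions `g ε = b^ε • f`, `b(w) = v/(v + i)`, `v = e^{πw/a} - e^{πp/a}`
  set b : ℂ → ℂ := fun w => (cexp (↑(π / a) * w) - cexp (↑(π / a) * p)) /
    (cexp (↑(π / a) * w) - cexp (↑(π / a) * p) + I) with hbdef
  have hv_im : ∀ w ∈ im ⁻¹' Icc 0 a, 0 ≤ (cexp (↑(π / a) * w) - cexp (↑(π / a) * p)).im := by
    intro w hw
    rw [sub_im, exp_mul_im_eq_zero ha hp, sub_zero]
    exact exp_mul_im_nonneg ha hw
  have hb_le : ∀ w ∈ im ⁻¹' Icc 0 a, ‖b w‖ ≤ 1 := fun w hw => norm_div_add_I_le_one (hv_im w hw)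
  have hb_slit : ∀ w ∈ im ⁻¹' Icc 0 a, w ≠ p → b w ∈ slitPlane := fun w hw hwp =>
    div_add_I_mem_slitPlane (hv_im w hw)
      (fun h0 => hwp ((exp_mul_eq_iff ha hw hpmem).1 (sub_eq_zero.1 h0)))
  have hbp : b p = 0 := by
    simp only [hbdef, sub_self, zero_div]
  have hbc : ContinuousOn b (im ⁻¹' Icc 0 a) :=
    ContinuousOn.div (by fun_prop) (by fun_prop) fun w hw => add_I_ne_zero (hv_im w hw)
  have hbd : ∀ w ∈ im ⁻¹' Icc 0 a, DifferentiableAt ℂ b w := fun w hw =>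
    DifferentiableAt.div (by fun_prop) (by fun_prop) (add_I_ne_zero (hv_im w hw))
  have hbz : b z ≠ 0 := slitPlane_ne_zero (hb_slit z hzcl hzp)
  have key : ∀ ε : ℝ, 0 < ε → ‖f z‖ ≤ C / ‖b z‖ ^ ε := by
    intro ε hε
    have hεC : (ε : ℂ) ≠ 0 := ofReal_ne_zero.2 hε.ne'
    set g : ℂ → E := fun w => (b w) ^ (ε : ℂ) • f w with hgdef
    have hnormg : ∀ w, ‖g w‖ = ‖b w‖ ^ ε * ‖f w‖ := fun w => by
      rw [hgdef, norm_smul, norm_cpow_real]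
    have hgp : g p = 0 := by
      simp only [hgdef, hbp, zero_cpow hεC, zero_smul]
    -- bound on the closed strip
    have hgK : ∀ w ∈ im ⁻¹' Icc 0 a, ‖g w‖ ≤ K := by
      intro w hw
      by_cases hwp : w = p
      · rw [hwp, hgp, norm_zero]; exact hK0
      · rw [hnormg]
        calc ‖b w‖ ^ ε * ‖f w‖ ≤ 1 * K :=
              mul_le_mul (Real.rpow_le_one (norm_nonneg _) (hb_le w hw) hε.le)
                (hK w ⟨hw, hwp⟩) (norm_nonneg _) zero_le_one
          _ = K := one_mul K
    -- differentiability inside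
    have hgd : DifferentiableOn ℂ g (im ⁻¹' Ioo 0 a) := by
      intro w hw
      have hwcl : w ∈ im ⁻¹' Icc 0 a := ⟨hw.1.le, hw.2.le⟩
      have hwp : w ≠ p := fun h => hw.2.ne (by rw [h, hp])
      refine DifferentiableAt.differentiableWithinAt ?_
      refine DifferentiableAt.smul ?_ (hd.differentiableAt (isOpen_im_preimage_Ioo.mem_nhds hw))
      exact (hbd w hwcl).cpow_const (hb_slit w hwcl hwp)
    -- continuity on the closed strip
    have hgc : ContinuousOn g (im ⁻¹' Icc 0 a) := by
      intro w hw
      by_cases hwp : w = p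
      · -- at the exceptional point: `g → 0 = g p`
        subst hwp
        rw [ContinuousWithinAt, hgp]
        have hbt : Tendsto b (𝓝[im ⁻¹' Icc 0 a] w) (𝓝 0) := by
          have := hbc w hw
          rw [ContinuousWithinAt, hbp] at this
          exact this
        have hpow : Tendsto (fun u => ‖b u‖ ^ ε * K) (𝓝[im ⁻¹' Icc 0 a] w) (𝓝 (0 * K)) := by
          refine Tendsto.mul_const K ?_
          have h1 : Tendsto (fun u => ‖b u‖) (𝓝[im ⁻¹' Icc 0 a] w) (𝓝 0) := by
            simpa using hbt.norm
          have h2 : Tendsto (fun r : ℝ => r ^ ε) (𝓝 0) (𝓝 ((0 : ℝ) ^ ε)) :=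
            (Real.continuousAt_rpow_const 0 ε (Or.inr hε.le)).tendsto
          rw [Real.zero_rpow hε.ne'] at h2
          exact h2.comp h1
        rw [zero_mul] at hpow
        refine squeeze_zero_norm' ?_ hpow
        filter_upwards [self_mem_nhdsWithin] with u hu
        by_cases hup : u = w
        · rw [hup, hgp, norm_zero]; positivity
        · rw [hnormg]
          exact mul_le_mul_of_nonneg_left (hK u ⟨hu, hup⟩) (Real.rpow_nonneg (norm_nonneg _) _)
      · have hfc : ContinuousWithinAt f (im ⁻¹' Icc 0 a) w := by
          refine (hc w ⟨hw, hwp⟩).mono_of_mem_nhdsWithin ?_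
          exact mem_nhdsWithin.2 ⟨{p}ᶜ, isOpen_compl_singleton, hwp, fun u hu => ⟨hu.2, hu.1⟩⟩
        refine ContinuousWithinAt.smul ?_ hfc
        exact (hbc w hw).cpow continuousWithinAt_const (hb_slit w hw hwp)
    have hgdc : DiffContOnCl ℂ g (im ⁻¹' Ioo 0 a) :=
      ⟨hgd, by rw [closure_im_preimage_Ioo ha]; exact hgc⟩
    -- boundary bounds
    have hg0 : ∀ w : ℂ, w.im = 0 → ‖g w‖ ≤ C := by
      intro w hw0
      have hwcl : w ∈ im ⁻¹' Icc 0 a := by simp [hw0, ha.le]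
      rw [hnormg]
      calc ‖b w‖ ^ ε * ‖f w‖ ≤ 1 * C :=
            mul_le_mul (Real.rpow_le_one (norm_nonneg _) (hb_le w hwcl) hε.le) (h0 w hw0)
              (norm_nonneg _) zero_le_one
        _ = C := one_mul C
    have hg1 : ∀ w : ℂ, w.im = a → ‖g w‖ ≤ C := by
      intro w hw1
      by_cases hwp : w = p
      · rw [hwp, hgp, norm_zero]; exact hC0
      · have hwcl : w ∈ im ⁻¹' Icc 0 a := by simp [hw1, ha.le]
        rw [hnormg]
        calc ‖b w‖ ^ ε * ‖f w‖ ≤ 1 * C :=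
              mul_le_mul (Real.rpow_le_one (norm_nonneg _) (hb_le w hwcl) hε.le) (h1 w hw1 hwp)
                (norm_nonneg _) zero_le_one
          _ = C := one_mul C
    have := norm_le_of_strip ha hgdc hgK hg0 hg1 hzcl
    rw [hnormg] at this
    have hpos : 0 < ‖b z‖ ^ ε := Real.rpow_pos_of_pos (norm_pos_iff.2 hbz) ε
    rw [le_div_iff₀ hpos, mul_comm]
    exact this
  -- let `ε ↓ 0`
  have hpow : Tendsto (fun ε : ℝ => ‖b z‖ ^ ε) (𝓝[>] 0) (𝓝 (‖b z‖ ^ (0 : ℝ))) :=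
    (Real.continuousAt_const_rpow (norm_pos_iff.2 hbz).ne').tendsto.mono_left nhdsWithin_le_nhds
  rw [Real.rpow_zero] at hpow
  have hlim : Tendsto (fun ε : ℝ => C / ‖b z‖ ^ ε) (𝓝[>] 0) (𝓝 (C / 1)) :=
    tendsto_const_nhds.div hpow one_ne_zero
  rw [div_one] at hlim
  exact ge_of_tendsto hlim (eventually_nhdsWithin_of_forall fun ε hε => key ε hε)

end OffPoint

/-! ### Real boundary values force a bounded analytic function on the strip to be constant -/

/-- **A bounded analytic function on the strip which is real on both boundary lines is constant.**
Let `f` be analytic in `0 < im z < a`, continuous and bounded on the closed strip minus a point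
`p` of the upper boundary line, with `im f = 0` on `im z = 0` and on `im z = a`, `z ≠ p`. Then
`f` is constant on the closed strip off `p` (Phragmén–Lindelöf with the exceptional point `p`
applied to `e^{±if}`, which have modulus `1` on the boundary, gives `im f = 0` inside; a
holomorphic function with vanishing imaginary part is constant by the open mapping theorem).
Longo, *Lectures on Conformal Nets* I, proof of Thm. 2.3.3 (there by Schwarz reflection and
Liouville). [folklore] -/
theorem eq_const_of_im_eq_zero_on_boundary (ha : 0 < a) {f : ℂ → ℂ} {p : ℂ} (hp : p.im = a)
    (hd : DifferentiableOn ℂ f (im ⁻¹' Ioo 0 a)) (hc : ContinuousOn f (im ⁻¹' Icc 0 a \ {p}))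
    {K : ℝ} (hK : ∀ z ∈ im ⁻¹' Icc 0 a \ {p}, ‖f z‖ ≤ K)
    (h0 : ∀ z : ℂ, z.im = 0 → (f z).im = 0) (h1 : ∀ z : ℂ, z.im = a → z ≠ p → (f z).im = 0)
    {z : ℂ} (hz : z ∈ im ⁻¹' Icc 0 a \ {p}) : f z = f 0 := by
  -- Step 1: `im f = 0` in the open strip.
  have him : ∀ w ∈ im ⁻¹' Ioo 0 a, (f w).im = 0 := by
    intro w hw
    have hnorm : ∀ (s : ℂ) (u : ℂ), ‖cexp (s * I * f u)‖ = Real.exp (-(s * I * f u).im * 0 + (s * I * f u).re) := by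
      intro s u; rw [norm_exp]; ring_nf
    -- generic application to `exp (s * I * f)` for `s = ±1`
    have aux : ∀ s : ℝ, (s = 1 ∨ s = -1) → Real.exp (-(s * (f w).im)) ≤ 1 := by
      intro s hs
      have hs2 : |s| = 1 := by rcases hs with rfl | rfl <;> simp
      set g : ℂ → ℂ := fun u => cexp ((s : ℂ) * I * f u) with hgdef
      have hng : ∀ u, ‖g u‖ = Real.exp (-(s * (f u).im)) := by
        intro u
        rw [hgdef, norm_exp]
        congr 1
        simp [mul_re, mul_im]
      have hgd : DifferentiableOn ℂ g (im ⁻¹' Ioo 0 a) := by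
        intro u hu
        exact (((differentiableAt_const _).mul
          (hd.differentiableAt (isOpen_im_preimage_Ioo.mem_nhds hu))).cexp).differentiableWithinAt
      have hgc : ContinuousOn g (im ⁻¹' Icc 0 a \ {p}) :=
        (continuousOn_const.mul hc).cexp
      have hgK : ∀ u ∈ im ⁻¹' Icc 0 a \ {p}, ‖g u‖ ≤ Real.exp K := by
        intro u hu
        rw [hng, Real.exp_le_exp]
        calc -(s * (f u).im) ≤ |-(s * (f u).im)| := le_abs_self _
          _ = |(f u).im| := by rw [abs_neg, abs_mul, hs2, one_mul]
          _ ≤ ‖f u‖ := abs_im_le_norm _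
          _ ≤ K := hK u hu
      have hg0 : ∀ u : ℂ, u.im = 0 → ‖g u‖ ≤ 1 := by
        intro u hu; rw [hng, h0 u hu]; simp
      have hg1 : ∀ u : ℂ, u.im = a → u ≠ p → ‖g u‖ ≤ 1 := by
        intro u hu hup; rw [hng, h1 u hu hup]; simp
      have := norm_le_of_strip_off_point ha hp hgd hgc hgK hg0 hg1 hw
      rwa [hng] at this
    have hle : (f w).im ≤ 0 := by
      have := aux (-1) (Or.inr rfl)
      simp only [neg_mul, one_mul, neg_neg, Real.exp_le_one_iff] at this
      exact this
    have hge : 0 ≤ (f w).im := by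
      have := aux 1 (Or.inl rfl)
      simp only [one_mul, Real.exp_le_one_iff, neg_nonpos] at this
      exact this
    exact le_antisymm hle hge
  -- Step 2: `f` is constant in the open strip (open mapping theorem).
  have hopen : IsOpen (im ⁻¹' Ioo 0 a) := isOpen_im_preimage_Ioo
  have hconn : IsConnected (im ⁻¹' Ioo 0 a) := by
    refine ⟨⟨(a / 2 : ℝ) * I, ?_⟩, convex_im_preimage_Ioo.isPreconnected⟩
    simp [ha, half_lt_self ha]
  obtain ⟨c, hc'⟩ := AnalyticOnNhd.eq_const_of_im_eq_const (hd.analyticOnNhd hopen) him hopen hconn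
  -- Step 3: extend to the closed strip off `p` by continuity.
  have hsub : im ⁻¹' Ioo 0 a ⊆ im ⁻¹' Icc 0 a \ {p} := fun w hw =>
    ⟨⟨hw.1.le, hw.2.le⟩, fun h => hw.2.ne (by rw [show w = p from h, hp])⟩
  have hcl : im ⁻¹' Icc 0 a \ {p} ⊆ closure (im ⁻¹' Ioo 0 a) := by
    rw [closure_im_preimage_Ioo ha]; exact fun w hw => hw.1
  have heq : EqOn f (fun _ => c) (im ⁻¹' Icc 0 a \ {p}) :=
    EqOn.of_subset_closure (fun w hw => hc' w hw) hc continuousOn_const hsub hcl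
  have h0mem : (0 : ℂ) ∈ im ⁻¹' Icc 0 a \ {p} :=
    ⟨by simp [ha.le], fun h => ha.ne' (by rw [← hp, ← show (0:ℂ) = p from h]; simp)⟩
  rw [heq hz, heq h0mem]

/-! ### Conjugate coordinates -/

/-- **`z ↦ conj (g (−z̄))` is holomorphic** at `z` when `g` is holomorphic at `−z̄` (the reflection
`w ↦ −w̄` preserves horizontal strips `0 ≤ im w ≤ a`). Mathlib's `HasDerivAt.conj_conj` composed
with `w ↦ −w`. [folklore] -/
theorem differentiableAt_conj_comp_neg_conj {g : ℂ → ℂ} {z : ℂ}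
    (hg : DifferentiableAt ℂ g (-conj z)) :
    DifferentiableAt ℂ (fun w => conj (g (-conj w))) z := by
  have h1 : DifferentiableAt ℂ (fun w => g (-w)) (conj z) :=
    hg.comp (conj z) differentiable_neg.differentiableAt
  have h2 := h1.hasDerivAt.conj_conj
  rw [Complex.conj_conj] at h2
  exact h2.differentiableAt

/-- `w ↦ −w̄` maps the closed strip `0 ≤ im w ≤ a` to itself. [folklore] -/
theorem neg_conj_mem_im_preimage_Icc {z : ℂ} (hz : z ∈ im ⁻¹' Icc 0 a) :
    -conj z ∈ im ⁻¹' Icc 0 a := by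
  simpa using hz

/-- `w ↦ −w̄` maps the open strip `0 < im w < a` to itself. [folklore] -/
theorem neg_conj_mem_im_preimage_Ioo {z : ℂ} (hz : z ∈ im ⁻¹' Ioo 0 a) :
    -conj z ∈ im ⁻¹' Ioo 0 a := by
  simpa using hz

/-- `w ↦ −w̄` is continuous. [folklore] -/
theorem continuous_neg_conj : Continuous fun w : ℂ => -conj w :=
  (continuous_conj).neg

end Literature.Analysis.Complex
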